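import Summits.AtomisticToContinuum.BoseEinsteinCondensation.Theses.BECHardSphereReduction
import Summits.AtomisticToContinuum.BoseEinsteinCondensation.Theorems.BECHardSphereReductionZeroModeNonVacuity
import Literature.MathematicalPhysics.QuantumManyBody.NeumannMomentumCutoffs
import Literature.MathematicalPhysics.QuantumManyBody.DiluteBoseGasUpperBoundLocalization
import Literature.MathematicalPhysics.QuantumManyBody.HardCoreScatteringLength
import Literature.MathematicalPhysics.QuantumManyBody.BoseGasMergeOccupation
import HarnessLib

/-!
# `HardSphereZeroMode` (stmt-11888) and the stub `stub_sparseZeroMode` of crux `HardSphereBEC`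
# (stmt-11885) are INFRARED statements: the ultraviolet half is certified here

Route `BECHardSphereReduction`, line `registered` (`Cruxes/HardSphereBEC/Lines/birth.lean`), lead c4.
Units `a = 1`, `ħ = 2m = 1`; `HS₁ = ⊤·1_{[0,1]}`; `L = L_N(η) = (N/η)^{1/3}`; `φ₀ = L^{-3/2}·1_{Λ_L}`.

For a Dirichlet trial state `Ψ` in `Λ_L^N` the expected number of particles outside the constant
mode splits over the NEUMANN eigenbasis `u_k = ∏ c_{kᵢ} L^{-1/2} cos(kᵢπxᵢ/L)` of the box
([FournaisEtAl2024, §2.3], vendored in `NeumannMomentumCutoffs`):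
`N = ⟨φ₀,γ_Ψφ₀⟩ + n₊ᴸ(K) + n₊ᴴ(K)`, where `n₊ᴸ(K)` counts the modes `0 < π|k| ≤ K`
(momenta `|p| ≤ K/L`) and `n₊ᴴ(K)` the rest, and the kinetic spectral gap gives
`n₊ᴴ(K) ≤ (L/K)² ∫|∇Ψ|² ≤ (L/K)² ⟨Ψ, H_N Ψ⟩`.  With Dyson's upper bound
`E₀(HS₁, N, L_N η) ≤ 4πη(1 + Cη^{1/3})N ≤ 8πηN` (eventually, `η` small; PROVED in the tree,
`eventually_groundStateEnergy_le_dyson`, `a(HS₁) = 1`) and the cut-off `K = √(32πη/c)·L`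
(momenta `|p| ≤ √(32πη/c)`, about `(32π/c)^{3/2}η^{1/2}N/(6π²)` modes) the ultraviolet part of every
near-minimiser is `≤ cN/4 + O(1)`.  Consequently (all statements below are kernel-checked):

* `sparseZeroMode_of_infraredBound` — the registered stub `stub_sparseZeroMode` FOLLOWS from the
  **sparse infrared bound** "for every `η₀ > 0` some `η ∈ (0,η₀]` and `c > 0` have, eventually in `N`
  and for some slack `δ > 0`, `n₊ᴸ(√(32πη/c)·L) + 2cN ≤ N` for every `δ`-near-minimiser";
* `infraredBound_of_sparseZeroMode` — and IMPLIES it back (with `c/2`, at every cut-off): the stub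
  is EQUIVALENT to a statement about the `O(√η·N)` softest non-constant Neumann modes only;
* `hardSphereZeroMode_of_infraredBound` / `infraredBound_of_hardSphereZeroMode` — the same for the
  support item `HardSphereZeroMode` (stmt-11888) on a whole interval of densities.

So the open content of stub₁ / 11888 is purely infrared: an occupation bound for the soft Neumann
modes `0 < |p| ≤ √(32πη/c)` of the Dirichlet near-ground states, uniformly along `L_N(η) → ∞`.
-/

noncomputable section

namespace Summit.AtomisticToContinuum.BoseEinsteinCondensation.Cruxes.HardSphereBEC

open MeasureTheory ENNReal Filter Topology Literature.MathematicalPhysics.QuantumManyBody.BoseGas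
open Literature.MathematicalPhysics.QuantumManyBody.NeumannBox
open Summit.AtomisticToContinuum.BoseEinsteinCondensation.Theses.BECHardSphereReduction
open Summit.AtomisticToContinuum.BoseEinsteinCondensation.Theorems

/-! ### The unit hard sphere: scattering length and Dyson's bound in the form used here -/

/-- **`a(HS₁) = 1`**: the scattering length of the unit hard-sphere potential `⊤·1_{[0,1]}` is `1`
(core of radius `1`, range `1`). [cite: LSSY2005, Ch. 2, paragraph after (2.1)] -/
theorem scatteringLength_unitHardSphere :
    scatteringLength (Set.indicator (Set.Iic 1) (fun _ : ℝ => (⊤ : ℝ≥0∞))) = ENNReal.ofReal 1 :=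
  le_antisymm (scatteringLength_le_range zero_le_one hardSphere_range_one)
    (ofReal_le_scatteringLength_of_core fun r _ hr =>
      Set.indicator_of_mem (show r ∈ Set.Iic (1 : ℝ) from hr.le) _)

/-- **Dyson's upper bound for unit hard spheres, simplified**: there is `η₁ > 0` such that for every
reduced density `0 < η < η₁`, eventually in `N`,
`E₀(HS₁, N, L_N η) ≤ 8πηN` (from `E₀ ≤ 4πη(1 + Cη^{1/3})N` with `Cη^{1/3} ≤ 1`).
[cite: LSSY2005, Thm. 2.2 (2.14)–(2.15); Dyson1957] -/
theorem eventually_groundStateEnergy_hardSphere_le_eight_pi :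
    ∃ η₁ : ℝ, 0 < η₁ ∧ ∀ η : ℝ, 0 < η → η < η₁ → ∀ᶠ N : ℕ in atTop,
      groundStateEnergy (Set.indicator (Set.Iic 1) (fun _ : ℝ => (⊤ : ℝ≥0∞))) N (sideLength η N) ≤
        ENNReal.ofReal (8 * Real.pi * η * N) := by
  have hfin : scatteringLength (Set.indicator (Set.Iic 1) (fun _ : ℝ => (⊤ : ℝ≥0∞))) ≠ ⊤ := by
    rw [scatteringLength_unitHardSphere]; exact ENNReal.ofReal_ne_top
  have hpos : 0 < scatteringLength (Set.indicator (Set.Iic 1) (fun _ : ℝ => (⊤ : ℝ≥0∞))) := by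
    rw [scatteringLength_unitHardSphere]; simp
  obtain ⟨C, ρ₀, hC, hρ₀, h⟩ :=
    eventually_groundStateEnergy_le_dyson hardSphere_range_one measurable_hardSphere hfin hpos
  have ha : (scatteringLength (Set.indicator (Set.Iic 1) (fun _ : ℝ => (⊤ : ℝ≥0∞)))).toReal = 1 := by
    rw [scatteringLength_unitHardSphere, ENNReal.toReal_ofReal zero_le_one]
  refine ⟨min ρ₀ (C⁻¹ ^ 3), lt_min hρ₀ (by positivity), fun η hη hηlt => ?_⟩
  have hηρ : η < ρ₀ := hηlt.trans_le (min_le_left _ _)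
  have hηC : η ≤ C⁻¹ ^ 3 := (hηlt.trans_le (min_le_right _ _)).le
  filter_upwards [h η hη hηρ] with N hN
  refine hN.trans (ENNReal.ofReal_le_ofReal ?_)
  rw [ha]
  have h13 : (η * 1 ^ 3) ^ ((1 : ℝ) / 3) ≤ C⁻¹ := by
    rw [one_pow, mul_one]
    calc η ^ ((1 : ℝ) / 3) ≤ (C⁻¹ ^ 3) ^ ((1 : ℝ) / 3) :=
          Real.rpow_le_rpow hη.le hηC (by norm_num)
      _ = C⁻¹ := by
          rw [show ((1 : ℝ) / 3) = ((3 : ℕ) : ℝ)⁻¹ by norm_num,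
            Real.pow_rpow_inv_natCast (by positivity) (by norm_num)]
  have hC1 : C * (η * 1 ^ 3) ^ ((1 : ℝ) / 3) ≤ 1 := by
    calc C * (η * 1 ^ 3) ^ ((1 : ℝ) / 3) ≤ C * C⁻¹ := by gcongr
      _ = 1 := mul_inv_cancel₀ hC.ne'
  have hN0 : (0 : ℝ) ≤ N := Nat.cast_nonneg N
  have hπ : 0 < Real.pi := Real.pi_pos
  nlinarith [mul_nonneg (mul_nonneg (mul_nonneg (by norm_num : (0:ℝ) ≤ 4) hπ.le) hη.le) hN0]

/-! ### Dirichlet trial states on the Neumann box: the three-way split `n₀ + n₊ᴸ + n₊ᴴ = N` -/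

variable {N n : ℕ} {L : ℝ}

/-- A Dirichlet trial state vanishes off the half-open cell `[0,L)^{3N} ⊇ Λ_L^N`, so cutting it off
there does nothing. [folklore] -/
theorem indicator_cellN_trialState (Ψ : TrialState N L) : (cellN N L).indicator Ψ.ψ = Ψ.ψ := by
  funext X
  by_cases hX : X ∈ cellN N L
  · exact Set.indicator_of_mem hX _
  · rw [Set.indicator_of_notMem hX]
    refine (Ψ.eq_zero X fun hXbox => hX fun i k => ?_).symm
    exact Set.Ioo_subset_Ico_self (hXbox i k)

/-- **The stub's constant mode is Fournais's `n₀`**: for a Dirichlet trial state, the occupation of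
`φ₀ = L^{-3/2}·1_{Λ_L}` (open box) equals `condensateOccupation N L` (constant mode of the half-open
cell, state cut off to the cell) — the modes agree a.e. and the cut-off is void. [folklore] -/
theorem occupation_boxMode_eq_condensateOccupation (Ψ : TrialState N L) :
    occupation N ((box L).indicator fun _ => ((Real.sqrt (L ^ 3))⁻¹ : ℂ)) Ψ.ψ =
      condensateOccupation N L Ψ.ψ := by
  rw [condensateOccupation, indicator_cellN_trialState, constantMode]
  exact occupation_congr_ae (indicator_ae_eq_of_ae_eq_set (box_ae_eq_cell L)) Ψ.ψ

/-- **`⟨φ₀,γ_Ψφ₀⟩ + n₊ᴸ(K) + n₊ᴴ(K) = N`** for an `(n+1)`-body Dirichlet trial state (Bose-symmetric,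
normalised) in the box of side `L > 0`, for every cut-off `K ≥ 0` (`P + Q^L + Q^H = 1` in the
Neumann eigenbasis). [cite: FournaisEtAl2024, after (2.11)] -/
theorem occupation_add_nPlusLow_add_nPlusHigh {K : ℝ} (hK : 0 ≤ K) (hL : 0 < L)
    (Ψ : TrialState (n + 1) L) :
    occupation (n + 1) ((box L).indicator fun _ => ((Real.sqrt (L ^ 3))⁻¹ : ℂ)) Ψ.ψ +
        nPlusLow K L (n + 1) Ψ.ψ + nPlusHigh K L (n + 1) Ψ.ψ = ((n + 1 : ℕ) : ℝ≥0∞) := by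
  rw [occupation_boxMode_eq_condensateOccupation]
  exact condensateOccupation_add_nPlusLow_add_nPlusHigh hK hL Ψ.toNeumann Ψ.symm

/-- **The ultraviolet part costs energy**: `n₊ᴴ(K) ≤ (L/K)² ⟨Ψ, H_N Ψ⟩` for every Dirichlet trial
state, every `K > 0` and every pair potential `v ≥ 0` (kinetic spectral gap `|p|² > (K/L)²` on the
high modes; the interaction is nonnegative). [cite: FournaisEtAl2024, (2.12)] -/
theorem nPlusHigh_le_mul_energy {K : ℝ} (hK : 0 < K) (hL : 0 < L) (v : ℝ → ℝ≥0∞)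
    (Ψ : TrialState N L) :
    nPlusHigh K L N Ψ.ψ ≤ ENNReal.ofReal ((L / K) ^ 2) * energy v Ψ := by
  refine (nPlusHigh_le_mul_lintegral_kineticDensity hK hL Ψ.contDiff).trans ?_
  gcongr
  exact (setLIntegral_le_lintegral _ _).trans (lintegral_mono fun X => le_self_add)

/-! ### The bookkeeping inequality -/

/-- From `occ + low + high = N`, `low + A ≤ N`, `high ≤ B` and `C + B ≤ A` (all in `ℝ≥0∞`, `B`
finite) conclude `C ≤ occ`. [folklore] -/
theorem le_occ_of_split {occ low high A B C T : ℝ≥0∞} (hT : T ≠ ⊤) (hsum : occ + low + high = T)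
    (hIR : low + A ≤ T) (hUV : high ≤ B) (hB : B ≠ ⊤) (hCB : C + B ≤ A) : C ≤ occ := by
  have hlow : low ≠ ⊤ := ne_top_of_le_ne_top hT
    (by rw [← hsum]; exact (le_add_left le_rfl).trans (le_add_right le_rfl))
  have h1 : low + A ≤ low + (occ + high) := by
    calc low + A ≤ T := hIR
      _ = low + (occ + high) := by rw [← hsum]; ring
  have h2 : A ≤ occ + high := (ENNReal.add_le_add_iff_left hlow).1 h1
  have h3 : C + B ≤ occ + B := hCB.trans (h2.trans (add_le_add le_rfl hUV))
  exact (ENNReal.add_le_add_iff_right hB).1 h3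

/-! ### Deterministic core: infrared bound + energy bound ⟹ zero-mode bound, one `N` at a time -/

/-- **Core estimate at fixed `N = n+1`.**  Let `η, c > 0`, `L = L_{n+1}(η)`, `K = √(32πη/c)·L`.
If `E₀(HS₁, n+1, L) ≤ 8πη(n+1)`, `(n+1) ≥ 1/(24πη)`, and a Dirichlet trial state `Ψ` with
`⟨Ψ,HΨ⟩ ≤ E₀ + δ`, `δ ≤ 1`, satisfies the infrared bound `n₊ᴸ(K) + 2c(n+1) ≤ n+1`, then
`⟨φ₀, γ_Ψ φ₀⟩ ≥ c(n+1)`. [folklore] -/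
theorem zeroMode_of_infrared_core {η c : ℝ} (hη : 0 < η) (hc : 0 < c) {δ : ℝ≥0∞} (hδ : δ ≤ 1)
    (hE₀ : groundStateEnergy (Set.indicator (Set.Iic 1) (fun _ : ℝ => (⊤ : ℝ≥0∞))) (n + 1)
      (sideLength η (n + 1)) ≤ ENNReal.ofReal (8 * Real.pi * η * ((n + 1 : ℕ) : ℝ)))
    (hlarge : 1 / (24 * Real.pi * η) ≤ ((n + 1 : ℕ) : ℝ))
    (Ψ : TrialState (n + 1) (sideLength η (n + 1)))
    (hΨ : energy (Set.indicator (Set.Iic 1) (fun _ : ℝ => (⊤ : ℝ≥0∞))) Ψ ≤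
      groundStateEnergy (Set.indicator (Set.Iic 1) (fun _ : ℝ => (⊤ : ℝ≥0∞))) (n + 1)
        (sideLength η (n + 1)) + δ)
    (hIR : nPlusLow (Real.sqrt (32 * Real.pi * η / c) * sideLength η (n + 1))
        (sideLength η (n + 1)) (n + 1) Ψ.ψ + ENNReal.ofReal (2 * c * ((n + 1 : ℕ) : ℝ)) ≤
      ((n + 1 : ℕ) : ℝ≥0∞)) :
    ENNReal.ofReal (c * ((n + 1 : ℕ) : ℝ)) ≤ occupation (n + 1)
      ((box (sideLength η (n + 1))).indicator
        fun _ => ((Real.sqrt (sideLength η (n + 1) ^ 3))⁻¹ : ℂ)) Ψ.ψ := by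
  have hNpos : (0 : ℝ) < ((n + 1 : ℕ) : ℝ) := by exact_mod_cast Nat.succ_pos n
  have hL : 0 < sideLength η (n + 1) := Real.rpow_pos_of_pos (div_pos hNpos hη) _
  have hπ : 0 < Real.pi := Real.pi_pos
  have hq : 0 < 32 * Real.pi * η / c := by positivity
  have hK : 0 < Real.sqrt (32 * Real.pi * η / c) * sideLength η (n + 1) :=
    mul_pos (Real.sqrt_pos.2 hq) hL
  -- (L/K)² = c/(32πη)
  have hLK : (sideLength η (n + 1) / (Real.sqrt (32 * Real.pi * η / c) * sideLength η (n + 1))) ^ 2 =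
      c / (32 * Real.pi * η) := by
    rw [div_mul_eq_div_div_swap, div_self hL.ne', div_pow, one_pow, Real.sq_sqrt hq.le,
      one_div, inv_div]
  -- the ultraviolet bound
  have hUV : nPlusHigh (Real.sqrt (32 * Real.pi * η / c) * sideLength η (n + 1))
      (sideLength η (n + 1)) (n + 1) Ψ.ψ ≤
      ENNReal.ofReal (c * ((n + 1 : ℕ) : ℝ) / 4 + c / (32 * Real.pi * η)) := by
    calc nPlusHigh (Real.sqrt (32 * Real.pi * η / c) * sideLength η (n + 1))
          (sideLength η (n + 1)) (n + 1) Ψ.ψ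
        ≤ ENNReal.ofReal ((sideLength η (n + 1) /
              (Real.sqrt (32 * Real.pi * η / c) * sideLength η (n + 1))) ^ 2) *
            energy (Set.indicator (Set.Iic 1) (fun _ : ℝ => (⊤ : ℝ≥0∞))) Ψ :=
          nPlusHigh_le_mul_energy hK hL _ Ψ
      _ ≤ ENNReal.ofReal ((sideLength η (n + 1) /
              (Real.sqrt (32 * Real.pi * η / c) * sideLength η (n + 1))) ^ 2) *
            (ENNReal.ofReal (8 * Real.pi * η * ((n + 1 : ℕ) : ℝ)) + 1) := by
          gcongr
          exact hΨ.trans (add_le_add hE₀ hδ)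
      _ = ENNReal.ofReal (c * ((n + 1 : ℕ) : ℝ) / 4 + c / (32 * Real.pi * η)) := by
          rw [hLK, ← ENNReal.ofReal_one, ← ENNReal.ofReal_add (by positivity) zero_le_one,
            ← ENNReal.ofReal_mul (by positivity)]
          congr 1
          field_simp
          ring
  -- the arithmetic `cN + (cN/4 + c/(32πη)) ≤ 2cN` for `N ≥ 1/(24πη)`
  have hCB : ENNReal.ofReal (c * ((n + 1 : ℕ) : ℝ)) +
      ENNReal.ofReal (c * ((n + 1 : ℕ) : ℝ) / 4 + c / (32 * Real.pi * η)) ≤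
      ENNReal.ofReal (2 * c * ((n + 1 : ℕ) : ℝ)) := by
    rw [← ENNReal.ofReal_add (by positivity) (by positivity)]
    refine ENNReal.ofReal_le_ofReal ?_
    have h2 : 1 ≤ 24 * Real.pi * η * ((n + 1 : ℕ) : ℝ) := by
      rwa [div_le_iff₀' (by positivity)] at hlarge
    have h1 : c / (32 * Real.pi * η) ≤ 3 / 4 * (c * ((n + 1 : ℕ) : ℝ)) := by
      rw [div_le_iff₀ (by positivity)]
      nlinarith [mul_le_mul_of_nonneg_left h2 hc.le]
    nlinarith
  exact le_occ_of_split (ENNReal.natCast_ne_top (n + 1))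
    (occupation_add_nPlusLow_add_nPlusHigh hK.le hL Ψ) hIR hUV ENNReal.ofReal_ne_top hCB

/-- **Converse bookkeeping**: a zero-mode bound `C ≤ ⟨φ₀,γ_Ψφ₀⟩` leaves at most `N - C` for the
soft modes, at every cut-off `K ≥ 0`: `n₊ᴸ(K) + C ≤ N`. [folklore] -/
theorem nPlusLow_add_le_of_zeroMode {K : ℝ} (hK : 0 ≤ K) (hL : 0 < L) (Ψ : TrialState (n + 1) L)
    {C : ℝ≥0∞} (h : C ≤ occupation (n + 1) ((box L).indicator fun _ => ((Real.sqrt (L ^ 3))⁻¹ : ℂ)) Ψ.ψ) :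
    nPlusLow K L (n + 1) Ψ.ψ + C ≤ ((n + 1 : ℕ) : ℝ≥0∞) := by
  calc nPlusLow K L (n + 1) Ψ.ψ + C
      ≤ nPlusLow K L (n + 1) Ψ.ψ +
          occupation (n + 1) ((box L).indicator fun _ => ((Real.sqrt (L ^ 3))⁻¹ : ℂ)) Ψ.ψ :=
        add_le_add le_rfl h
    _ ≤ occupation (n + 1) ((box L).indicator fun _ => ((Real.sqrt (L ^ 3))⁻¹ : ℂ)) Ψ.ψ +
          nPlusLow K L (n + 1) Ψ.ψ + nPlusHigh K L (n + 1) Ψ.ψ := by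
        rw [add_comm]; exact le_add_right le_rfl
    _ = ((n + 1 : ℕ) : ℝ≥0∞) := occupation_add_nPlusLow_add_nPlusHigh hK hL Ψ

/-! ### Eventual forms: the stub `stub_sparseZeroMode` and the item `HardSphereZeroMode` -/

/-- **The sparse infrared bound implies the registered stub `stub_sparseZeroMode`** (conclusion =
the stub's signature verbatim).  Sparse infrared bound: for every threshold `η₀ > 0` there are
`η ∈ (0, η₀]` and `c > 0` such that, eventually in `N` and for some slack `δ > 0`, every
`δ`-near-minimiser of the unit-hard-sphere Dirichlet energy in the box `L_N(η)` has
`n₊ᴸ(√(32πη/c)·L_N(η)) + 2cN ≤ N`.  Proof: Dyson's bound below `η₁`, slack `min δ 1`, the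
core estimate for `N ≥ 1/(24πη)`. [folklore] -/
theorem sparseZeroMode_of_infraredBound
    (hIR : ∀ η₀ : ℝ, 0 < η₀ → ∃ η : ℝ, 0 < η ∧ η ≤ η₀ ∧ ∃ c : ℝ, 0 < c ∧ ∀ᶠ N : ℕ in atTop,
      ∃ δ : ℝ≥0∞, 0 < δ ∧ ∀ Ψ : TrialState N (sideLength η N),
        energy (Set.indicator (Set.Iic 1) (fun _ : ℝ => (⊤ : ℝ≥0∞))) Ψ ≤
          groundStateEnergy (Set.indicator (Set.Iic 1) (fun _ : ℝ => (⊤ : ℝ≥0∞))) N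
            (sideLength η N) + δ →
        nPlusLow (Real.sqrt (32 * Real.pi * η / c) * sideLength η N) (sideLength η N) N Ψ.ψ +
          ENNReal.ofReal (2 * c * N) ≤ (N : ℝ≥0∞)) :
    ∀ η₀ : ℝ, 0 < η₀ → ∃ η : ℝ, 0 < η ∧ η ≤ η₀ ∧ ∃ c : ℝ, 0 < c ∧ ∀ᶠ N : ℕ in Filter.atTop,
      ∃ δ : ENNReal, 0 < δ ∧ ∀ Ψ : TrialState N (sideLength η N),
        energy (Set.indicator (Set.Iic 1) (fun _ : ℝ => (⊤ : ENNReal))) Ψ ≤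
          groundStateEnergy (Set.indicator (Set.Iic 1) (fun _ : ℝ => (⊤ : ENNReal))) N
            (sideLength η N) + δ →
        ENNReal.ofReal (c * N) ≤ occupation N ((box (sideLength η N)).indicator
          fun _ => ((Real.sqrt (sideLength η N ^ 3))⁻¹ : ℂ)) Ψ.ψ := by
  obtain ⟨η₁, hη₁, hD⟩ := eventually_groundStateEnergy_hardSphere_le_eight_pi
  intro η₀ hη₀
  obtain ⟨η, hη, hηle, c, hc, hev⟩ := hIR (min η₀ (η₁ / 2)) (lt_min hη₀ (half_pos hη₁))
  refine ⟨η, hη, hηle.trans (min_le_left _ _), c, hc, ?_⟩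
  have hηlt : η < η₁ := (hηle.trans (min_le_right _ _)).trans_lt (half_lt_self hη₁)
  have hlarge : ∀ᶠ N : ℕ in atTop, 1 / (24 * Real.pi * η) ≤ (N : ℝ) :=
    tendsto_natCast_atTop_atTop.eventually_ge_atTop _
  filter_upwards [hev, hD η hη hηlt, hlarge, eventually_gt_atTop 0] with N hN hE₀ hNl hN0
  obtain ⟨δ, hδ, hΨ⟩ := hN
  cases N with
  | zero => exact absurd hN0 (lt_irrefl 0)
  | succ n =>
    refine ⟨min δ 1, lt_min hδ one_pos, fun Ψ hΨE => ?_⟩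
    exact zeroMode_of_infrared_core hη hc (min_le_right _ _) hE₀ hNl Ψ hΨE
      (hΨ Ψ (hΨE.trans (add_le_add le_rfl (min_le_left _ _))))

/-- **… and conversely** (with half the constant, at the designated cut-off): the registered stub
implies the sparse infrared bound, so the two are EQUIVALENT — the stub is an infrared statement.
[folklore] -/
theorem infraredBound_of_sparseZeroMode
    (h : ∀ η₀ : ℝ, 0 < η₀ → ∃ η : ℝ, 0 < η ∧ η ≤ η₀ ∧ ∃ c : ℝ, 0 < c ∧ ∀ᶠ N : ℕ in Filter.atTop,
      ∃ δ : ENNReal, 0 < δ ∧ ∀ Ψ : TrialState N (sideLength η N),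
        energy (Set.indicator (Set.Iic 1) (fun _ : ℝ => (⊤ : ENNReal))) Ψ ≤
          groundStateEnergy (Set.indicator (Set.Iic 1) (fun _ : ℝ => (⊤ : ENNReal))) N
            (sideLength η N) + δ →
        ENNReal.ofReal (c * N) ≤ occupation N ((box (sideLength η N)).indicator
          fun _ => ((Real.sqrt (sideLength η N ^ 3))⁻¹ : ℂ)) Ψ.ψ) :
    ∀ η₀ : ℝ, 0 < η₀ → ∃ η : ℝ, 0 < η ∧ η ≤ η₀ ∧ ∃ c : ℝ, 0 < c ∧ ∀ᶠ N : ℕ in atTop,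
      ∃ δ : ℝ≥0∞, 0 < δ ∧ ∀ Ψ : TrialState N (sideLength η N),
        energy (Set.indicator (Set.Iic 1) (fun _ : ℝ => (⊤ : ℝ≥0∞))) Ψ ≤
          groundStateEnergy (Set.indicator (Set.Iic 1) (fun _ : ℝ => (⊤ : ℝ≥0∞))) N
            (sideLength η N) + δ →
        nPlusLow (Real.sqrt (32 * Real.pi * η / c) * sideLength η N) (sideLength η N) N Ψ.ψ +
          ENNReal.ofReal (2 * c * N) ≤ (N : ℝ≥0∞) := by
  intro η₀ hη₀
  obtain ⟨η, hη, hηle, c, hc, hev⟩ := h η₀ hη₀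
  refine ⟨η, hη, hηle, c / 2, half_pos hc, ?_⟩
  filter_upwards [hev, eventually_gt_atTop 0] with N hN hN0
  obtain ⟨δ, hδ, hΨ⟩ := hN
  cases N with
  | zero => exact absurd hN0 (lt_irrefl 0)
  | succ n =>
    refine ⟨δ, hδ, fun Ψ hΨE => ?_⟩
    have hL : 0 < sideLength η (n + 1) :=
      Real.rpow_pos_of_pos (div_pos (by exact_mod_cast Nat.succ_pos n) hη) _
    have h2 : 2 * (c / 2) * ((n + 1 : ℕ) : ℝ) = c * ((n + 1 : ℕ) : ℝ) := by ring
    rw [h2]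
    exact nPlusLow_add_le_of_zeroMode (by positivity) hL Ψ (hΨ Ψ hΨE)

/-- **The interval infrared bound implies the support item `HardSphereZeroMode`** (stmt-11888):
if below some `η₁ > 0` every reduced density `η` has a constant `c > 0` with, eventually in `N` and
for some slack, `n₊ᴸ(√(32πη/c)·L_N(η)) + 2cN ≤ N` for all near-minimisers, then zero-mode
condensation holds on an initial interval of densities. [folklore] -/
theorem hardSphereZeroMode_of_infraredBound
    (hIR : ∃ η₁ : ℝ, 0 < η₁ ∧ ∀ η : ℝ, 0 < η → η < η₁ → ∃ c : ℝ, 0 < c ∧ ∀ᶠ N : ℕ in atTop,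
      ∃ δ : ℝ≥0∞, 0 < δ ∧ ∀ Ψ : TrialState N (sideLength η N),
        energy (Set.indicator (Set.Iic 1) (fun _ : ℝ => (⊤ : ℝ≥0∞))) Ψ ≤
          groundStateEnergy (Set.indicator (Set.Iic 1) (fun _ : ℝ => (⊤ : ℝ≥0∞))) N
            (sideLength η N) + δ →
        nPlusLow (Real.sqrt (32 * Real.pi * η / c) * sideLength η N) (sideLength η N) N Ψ.ψ +
          ENNReal.ofReal (2 * c * N) ≤ (N : ℝ≥0∞)) :
    HardSphereZeroMode := by
  obtain ⟨η₂, hη₂, hD⟩ := eventually_groundStateEnergy_hardSphere_le_eight_pi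
  obtain ⟨η₁, hη₁, h⟩ := hIR
  unfold HardSphereZeroMode
  refine ⟨min η₁ η₂, lt_min hη₁ hη₂, fun η hη hηlt => ?_⟩
  obtain ⟨c, hc, hev⟩ := h η hη (hηlt.trans_le (min_le_left _ _))
  refine ⟨c, hc, ?_⟩
  have hlarge : ∀ᶠ N : ℕ in atTop, 1 / (24 * Real.pi * η) ≤ (N : ℝ) :=
    tendsto_natCast_atTop_atTop.eventually_ge_atTop _
  filter_upwards [hev, hD η hη (hηlt.trans_le (min_le_right _ _)), hlarge, eventually_gt_atTop 0]
    with N hN hE₀ hNl hN0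
  obtain ⟨δ, hδ, hΨ⟩ := hN
  cases N with
  | zero => exact absurd hN0 (lt_irrefl 0)
  | succ n =>
    refine ⟨min δ 1, lt_min hδ one_pos, fun Ψ hΨE => ?_⟩
    exact zeroMode_of_infrared_core hη hc (min_le_right _ _) hE₀ hNl Ψ hΨE
      (hΨ Ψ (hΨE.trans (add_le_add le_rfl (min_le_left _ _))))

/-- **… and conversely**: `HardSphereZeroMode` implies the interval infrared bound (constant halved),
so item 11888 too is EQUIVALENT to an occupation bound for the soft Neumann modes
`0 < |p| ≤ √(64πη/c)` of the near-minimisers. [folklore] -/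
theorem infraredBound_of_hardSphereZeroMode (hZ : HardSphereZeroMode) :
    ∃ η₁ : ℝ, 0 < η₁ ∧ ∀ η : ℝ, 0 < η → η < η₁ → ∃ c : ℝ, 0 < c ∧ ∀ᶠ N : ℕ in atTop,
      ∃ δ : ℝ≥0∞, 0 < δ ∧ ∀ Ψ : TrialState N (sideLength η N),
        energy (Set.indicator (Set.Iic 1) (fun _ : ℝ => (⊤ : ℝ≥0∞))) Ψ ≤
          groundStateEnergy (Set.indicator (Set.Iic 1) (fun _ : ℝ => (⊤ : ℝ≥0∞))) N
            (sideLength η N) + δ →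
        nPlusLow (Real.sqrt (32 * Real.pi * η / c) * sideLength η N) (sideLength η N) N Ψ.ψ +
          ENNReal.ofReal (2 * c * N) ≤ (N : ℝ≥0∞) := by
  obtain ⟨η₁, hη₁, h⟩ := hZ
  refine ⟨η₁, hη₁, fun η hη hηlt => ?_⟩
  obtain ⟨c, hc, hev⟩ := h η hη hηlt
  refine ⟨c / 2, half_pos hc, ?_⟩
  filter_upwards [hev, eventually_gt_atTop 0] with N hN hN0
  obtain ⟨δ, hδ, hΨ⟩ := hN
  cases N with
  | zero => exact absurd hN0 (lt_irrefl 0)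
  | succ n =>
    refine ⟨δ, hδ, fun Ψ hΨE => ?_⟩
    have hL : 0 < sideLength η (n + 1) :=
      Real.rpow_pos_of_pos (div_pos (by exact_mod_cast Nat.succ_pos n) hη) _
    have h2 : 2 * (c / 2) * ((n + 1 : ℕ) : ℝ) = c * ((n + 1 : ℕ) : ℝ) := by ring
    rw [h2]
    exact nPlusLow_add_le_of_zeroMode (by positivity) hL Ψ (hΨ Ψ hΨE)

end Summit.AtomisticToContinuum.BoseEinsteinCondensation.Cruxes.HardSphereBEC

end
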